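import Literature.Analysis.PDE.ABPHessian
import Literature.Analysis.Matrix.DetTraceAMGM
import Mathlib.Analysis.InnerProductSpace.PiL2
import Mathlib.LinearAlgebra.Matrix.ToLin
import Mathlib.LinearAlgebra.Determinant
import HarnessLib

/-!
# The pointwise determinant bound on the upper contact set (Gilbarg–Trudinger, Lemma 9.3)

On `Γ⁺` the Hessian matrix `H = [D²u(b_i,b_j)]` (in an orthonormal basis `b`) is negative
semidefinite, so for a positive semidefinite coefficient matrix `a = [a^{ij}]` the determinant–trace
inequality gives Gilbarg–Trudinger's
`𝒟 |det D²u| ≤ (−a^{ij}D_{ij}u / n)ⁿ`, `𝒟 = det a`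
— the bound that turns the normal-mapping inequality (Lemma 9.2) into the ABP estimate (Thm. 9.1).

* `hessianMatrix` — `H_{ij} = D²u(y)(b_i, b_j)`; `inner_fderiv_gradient_apply`,
  `det_fderiv_gradient_eq` — `det D(∇u)(y) = det H` (the normal mapping's Jacobian determinant
  is the Hessian determinant);
* `posSemidef_neg_hessianMatrix` — `−H ≥ 0` for `y ∈ Γ⁺`;
* `det_coeff_mul_abs_det_hessian_le` — `det a · |det H| ≤ ((−Σ a_{ij}H_{ij})/n)ⁿ`.

## References

* D. Gilbarg, N. S. Trudinger, *Elliptic Partial Differential Equations of Second Order* (2001),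
  §9.1, Lemma 9.3 and its proof. [GilbargTrudinger2001]
-/

noncomputable section

open Set Matrix InnerProductSpace RealInnerProductSpace Finset
open scoped MatrixOrder

namespace Literature.Analysis.PDE.ABP

variable {E : Type*} [NormedAddCommGroup E] [InnerProductSpace ℝ E] [CompleteSpace E]
  {ι : Type*} [Fintype ι] [DecidableEq ι]

/-- **The Hessian matrix** of `u` at `y` in the orthonormal basis `b`:
`H_{ij} = D²u(y)(b_i, b_j)`. [cite: GilbargTrudinger2001, §9.1] -/
def hessianMatrix (u : E → ℝ) (b : OrthonormalBasis ι ℝ E) (y : E) : Matrix ι ι ℝ :=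
  Matrix.of fun i j ↦ fderiv ℝ (fderiv ℝ u) y (b i) (b j)

omit [CompleteSpace E] [DecidableEq ι] in
/-- Unfolding lemma. [folklore] -/
@[simp] theorem hessianMatrix_apply (u : E → ℝ) (b : OrthonormalBasis ι ℝ E) (y : E) (i j : ι) :
    hessianMatrix u b y i j = fderiv ℝ (fderiv ℝ u) y (b i) (b j) := rfl

omit [Fintype ι] [DecidableEq ι] in
/-- **The derivative of the normal mapping is the Hessian**: `⟪D(∇u)(y) w, v⟫ = D²u(y)(w, v)`
(`∇u = ♯ ∘ Du` with the Riesz isometry `♯`). [folklore] -/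
theorem inner_fderiv_gradient_apply {u : E → ℝ} {y : E}
    (hD2 : DifferentiableAt ℝ (fderiv ℝ u) y) (v w : E) :
    ⟪fderiv ℝ (gradient u) y w, v⟫ = fderiv ℝ (fderiv ℝ u) y w v := by
  have hg : gradient u = fun x ↦ (toDual ℝ E).symm (fderiv ℝ u x) := by
    funext x; rfl
  have h1 : fderiv ℝ (gradient u) y =
      ((toDual ℝ E).symm : (E →L[ℝ] ℝ) →L[ℝ] E).comp (fderiv ℝ (fderiv ℝ u) y) := by
    rw [hg]
    exact ((toDual ℝ E).symm.toContinuousLinearEquiv.hasFDerivAt.comp y hD2.hasFDerivAt).fderiv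
  rw [h1]
  simp [toDual_symm_apply]

/-- The matrix of `D(∇u)(y)` in the orthonormal basis `b` is the transpose of the Hessian matrix.
[folklore] -/
theorem toMatrix_fderiv_gradient [FiniteDimensional ℝ E] {u : E → ℝ} {y : E}
    (hD2 : DifferentiableAt ℝ (fderiv ℝ u) y) (b : OrthonormalBasis ι ℝ E) :
    LinearMap.toMatrix b.toBasis b.toBasis (fderiv ℝ (gradient u) y : E →ₗ[ℝ] E) =
      (hessianMatrix u b y)ᵀ := by
  ext i j
  rw [LinearMap.toMatrix_apply, OrthonormalBasis.coe_toBasis_repr_apply,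
    OrthonormalBasis.repr_apply_apply, OrthonormalBasis.coe_toBasis, transpose_apply,
    hessianMatrix_apply, ← inner_fderiv_gradient_apply hD2, real_inner_comm]
  rfl

/-- **`det D(∇u)(y) = det H`**: the Jacobian determinant of the normal mapping is the Hessian
determinant. [cite: GilbargTrudinger2001, §9.1, (9.5)–(9.6)] -/
theorem det_fderiv_gradient_eq [FiniteDimensional ℝ E] {u : E → ℝ} {y : E}
    (hD2 : DifferentiableAt ℝ (fderiv ℝ u) y) (b : OrthonormalBasis ι ℝ E) :
    (fderiv ℝ (gradient u) y).det = (hessianMatrix u b y).det := by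
  rw [ContinuousLinearMap.det, ← LinearMap.det_toMatrix b.toBasis, toMatrix_fderiv_gradient hD2 b,
    det_transpose]

omit [CompleteSpace E] [DecidableEq ι] in
/-- The quadratic form of the Hessian matrix is the second derivative along `Σ xᵢ bᵢ`. [folklore] -/
theorem dotProduct_hessianMatrix_mulVec (u : E → ℝ) (b : OrthonormalBasis ι ℝ E) (y : E)
    (x : ι → ℝ) :
    x ⬝ᵥ (hessianMatrix u b y *ᵥ x) =
      fderiv ℝ (fderiv ℝ u) y (∑ i, x i • b i) (∑ j, x j • b j) := by
  have h1 : fderiv ℝ (fderiv ℝ u) y (∑ i, x i • b i) = ∑ i, x i • fderiv ℝ (fderiv ℝ u) y (b i) := by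
    simp only [map_sum, map_smul]
  have h2 : ∀ L : E →L[ℝ] ℝ, L (∑ j, x j • b j) = ∑ j, x j * L (b j) := fun L ↦ by
    simp only [map_sum, map_smul, smul_eq_mul]
  rw [h1, _root_.sum_apply]
  simp only [_root_.smul_apply, h2, smul_eq_mul, dotProduct, mulVec, hessianMatrix_apply,
    Finset.mul_sum]
  exact Finset.sum_congr rfl fun i _ ↦ Finset.sum_congr rfl fun j _ ↦ by ring

omit [DecidableEq ι] in
/-- **`−H ≥ 0` on the upper contact set** (for symmetric `D²u(y)`).
[cite: GilbargTrudinger2001, §9.1 (`D²u ≤ 0` on `Γ⁺`)] -/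
theorem posSemidef_neg_hessianMatrix {Ω : Set E} (hΩo : IsOpen Ω) {u : E → ℝ}
    (hdiff : ∀ x ∈ Ω, DifferentiableAt ℝ u x) {y : E} (hy : y ∈ upperContactSet u Ω)
    (hD2 : DifferentiableAt ℝ (fderiv ℝ u) y)
    (hsymm : ∀ v w, fderiv ℝ (fderiv ℝ u) y v w = fderiv ℝ (fderiv ℝ u) y w v)
    (b : OrthonormalBasis ι ℝ E) : (-hessianMatrix u b y).PosSemidef := by
  refine PosSemidef.of_dotProduct_mulVec_nonneg ?_ fun x ↦ ?_
  · -- Hermitian: `(−H)ᴴ = −Hᵀ = −H`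
    ext i j
    simp only [conjTranspose_apply, Matrix.neg_apply, star_trivial, hessianMatrix_apply, neg_inj]
    exact hsymm (b j) (b i)
  · have h := hessian_apply_self_nonpos_of_mem_upperContactSet hΩo hdiff hy hD2 (∑ i, x i • b i)
    have hq := dotProduct_hessianMatrix_mulVec u b y x
    simp only [star_trivial, neg_mulVec, dotProduct_neg]
    linarith

omit [DecidableEq ι] in
/-- The trace pairing `tr(a(−H)) = −Σ a_{ij}H_{ij}` for symmetric `H`. [folklore] -/
theorem trace_mul_neg_eq (a H : Matrix ι ι ℝ) (hH : ∀ i j, H i j = H j i) :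
    (a * -H).trace = -∑ i, ∑ j, a i j * H i j := by
  simp only [trace, diag_apply, mul_apply, Matrix.neg_apply, mul_neg, Finset.sum_neg_distrib]
  congr 1
  exact Finset.sum_congr rfl fun i _ ↦ Finset.sum_congr rfl fun j _ ↦ by rw [hH j i]

/-- **Gilbarg–Trudinger's pointwise bound (Lemma 9.3)**: for a positive semidefinite coefficient
matrix `a` and `y ∈ Γ⁺`,
`det a · |det H| ≤ ((−Σ_{ij} a_{ij}H_{ij}) / n)ⁿ` with `H` the Hessian matrix — i.e.
`𝒟|det D²u| ≤ (−a^{ij}D_{ij}u/n)ⁿ`. [cite: GilbargTrudinger2001, §9.1, Lemma 9.3] -/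
theorem det_coeff_mul_abs_det_hessian_le [Nonempty ι] {Ω : Set E} (hΩo : IsOpen Ω) {u : E → ℝ}
    (hdiff : ∀ x ∈ Ω, DifferentiableAt ℝ u x) {y : E} (hy : y ∈ upperContactSet u Ω)
    (hD2 : DifferentiableAt ℝ (fderiv ℝ u) y)
    (hsymm : ∀ v w, fderiv ℝ (fderiv ℝ u) y v w = fderiv ℝ (fderiv ℝ u) y w v)
    (b : OrthonormalBasis ι ℝ E) {a : Matrix ι ι ℝ} (ha : a.PosSemidef) :
    a.det * |(hessianMatrix u b y).det| ≤
      ((-∑ i, ∑ j, a i j * hessianMatrix u b y i j) / Fintype.card ι) ^ Fintype.card ι := by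
  have hneg := posSemidef_neg_hessianMatrix hΩo hdiff hy hD2 hsymm b
  have hH : ∀ i j, hessianMatrix u b y i j = hessianMatrix u b y j i := fun i j ↦ by
    rw [hessianMatrix_apply, hessianMatrix_apply]; exact hsymm (b i) (b j)
  -- `|det H| = det(−H)`
  have habs : |(hessianMatrix u b y).det| = (-hessianMatrix u b y).det := by
    have h0 : 0 ≤ (-hessianMatrix u b y).det := hneg.det_nonneg
    rw [det_neg] at h0 ⊢
    rcases neg_one_pow_eq_or ℝ (Fintype.card ι) with h1 | h1 <;> rw [h1] at h0 ⊢
    · rw [one_mul] at h0 ⊢; exact abs_of_nonneg h0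
    · rw [neg_one_mul] at h0 ⊢; exact abs_of_nonpos (by linarith)
  rw [habs, ← trace_mul_neg_eq a _ hH]
  exact Literature.Analysis.Matrix.ABP.det_mul_det_le_pow_trace ha hneg

end Literature.Analysis.PDE.ABP

end
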